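import Mathlib
import HarnessLib
import Summits.NavierStokesRegularity.NavierStokesRegularity.Theorems.AxisTwistDoorAveragedConeLiouvilleHolds
import Summits.NavierStokesRegularity.NavierStokesRegularity.Theorems.AxisTwistDoorTiltDominationLocEnergyClass
import Summits.NavierStokesRegularity.NavierStokesRegularity.Theorems.AxisTwistDoorTiltDominationLocNeckCircle
import Summits.NavierStokesRegularity.NavierStokesRegularity.Theorems.PoloidalWindowDoorPoloidalWindowRigidityWindow
import Literature.Analysis.FluidPDE.BarkerPrange2020VorticityAlignmentTypeIHolds
import Literature.Analysis.FluidPDE.CurlIsometryCovariance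
import Summits.NavierStokesRegularity.NavierStokesRegularity.Theorems.PoloidalWindowDoorPoloidalWindowRigidityRotate
import Summits.NavierStokesRegularity.NavierStokesRegularity.Theorems.HalfSpaceWindowDoorCirculationCarryingRigidityRotate
import Summits.NavierStokesRegularity.NavierStokesRegularity.Theorems.RellichScarSimilarityCovarianceRotationAB
import Summits.NavierStokesRegularity.NavierStokesRegularity.Theorems.AxisTwistDoorSignConeDefs

/-!
# AxisTwistDoor · crux `TiltDominationLoc` (stmt-NavierStokesRegularity-26991) · line `signcone` — THE KNOWN RUNG:
# a sign cone with NON-EMPTY INTERIOR (around `e₃`) means a pointwise Lei–Ren–Tian cone, hence a regular apex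

Line `signcone` (ns-idea-6 g7; skeleton of record of crux 26991, LEAD ns-atd-p1 g4) organises the one-signed Type-I
Liouville problem by the SIGN CONE `K(v) = {e : ⟪curl v(s) y, e⟫ ≥ 0 ∀ s < 0, ∀ y}` of the profile.  Its card files the case
«span of dimension 3 (non-empty interior) = a pointwise circular cone about some axis = the Lei–Ren–Tian hypothesis;
regular by the tree's `AveragedConeLiouville`» as KNOWN and subsumes it in the open stub `StubDihedralRigidity`.  This
file proves that known rung in the kernel, for a ball of directions about `e₃`:

* `norm_horizontal_le_of_ball_subset_signCone` — if every direction `e` with `‖e − e₃‖ ≤ r` (`0 < r`) is one-signed for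
  `v`, then POINTWISE `‖ω − ω₃e₃‖ ≤ r⁻¹ ω₃` (test the direction `e₃ − r ω_h/‖ω_h‖`);
* `circleCone_of_ball_subset_signCone` — hence the circle-averaged cone of the route with `K = r⁻¹`, `M = 0` on EVERY
  axis circle (continuity of the vorticity on circles, `analyticOnNhd_curl` ∘ `continuous_comp_circlePt`, and
  monotonicity of the interval integral; continuity of the curl from slice analyticity);
* `not_isBackwardSingularPoint_of_ball_subset_signCone` — so a class profile whose sign cone contains a ball about
  `e₃` is NOT backward-singular at the apex: the energy class is automatic (`exists_energyClass_of_typeI`) and crux 26889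
  `AveragedConeLiouville` (PROVED, `averagedConeLiouville_holds`) applies.

Consequence for the line (LEAD reading, no reshaping here): in `StubDihedralRigidity` one may assume the sign cone has
EMPTY interior, i.e. (closed convex cone in `ℝ³`) is contained in the plane spanned by `e₃` and the second direction —
the open content of the dihedral rung is the PLANAR-WEDGE sign cone.  (The version about an arbitrary interior direction
`e₀` follows by the det-one rotation covariance of the class exactly as in `…AxisTwistDoorRotationToAxis`; not repeated.)
WHAT THIS IS NOT: nothing here proves the dihedral rung, the crux, W4/W6, the leaf or any NS regularity statement (Clay A
OPEN).  Seat ns-atd-p1 (LEAD g4).  [cite: LeiRenTian2025, Thm 1.1 and Rem 1.2 (pointwise cone `|ω_h| ≤ C ω₃`)]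
-/

noncomputable section

-- the summit and its single sub-problem share the name (CONVENTIONS §1), as in every Theorems file
set_option linter.dupNamespace false

namespace Summit.NavierStokesRegularity.NavierStokesRegularity.Theorems.AxisTwistDoorSignConeInterior

open Set Function Filter Topology MeasureTheory Metric
open scoped InnerProductSpace RealInnerProductSpace
open Literature.Analysis Literature.Analysis.FluidPDE
open Summit.NavierStokesRegularity.NavierStokesRegularity.Theorems.AxisTwistDoorTiltDominationLocEnergyClass
  (exists_energyClass_of_typeI)
open Summit.NavierStokesRegularity.NavierStokesRegularity.Theorems.TiltDominationLoc.NeckLength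
  (continuous_comp_circlePt)
open Summit.NavierStokesRegularity.NavierStokesRegularity.Theorems.PoloidalWindowDoorPoloidalWindowRigidityWindow
  (isTypeIAncientMild_of_class)

variable {C : ℝ} {v : ℝ → EuclideanSpace ℝ (Fin 3) → EuclideanSpace ℝ (Fin 3)}

/-! ### §1 A ball of one-signed directions about `e₃` is a pointwise cone -/

/-- **Pointwise cone from a ball in the sign cone** (linear algebra, any vector `w`): if `⟪w, e⟫ ≥ 0` for every `e`
with `‖e − e₃‖ ≤ r`, `0 < r`, then `‖w − ⟪w,e₃⟫e₃‖ ≤ r⁻¹ ⟪w, e₃⟫` (test `e = e₃ − r h/‖h‖`, `h` the part of `w`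
orthogonal to `e₃`). [cite: LeiRenTian2025, Rem 1.2] -/
theorem norm_sub_inner_smul_le_of_ball {w : EuclideanSpace ℝ (Fin 3)} {r : ℝ} (hr : 0 < r)
    (hball : ∀ e : EuclideanSpace ℝ (Fin 3), ‖e - EuclideanSpace.single (2 : Fin 3) (1 : ℝ)‖ ≤ r → 0 ≤ ⟪w, e⟫_ℝ) :
    ‖w - ⟪w, (EuclideanSpace.single (2 : Fin 3) (1 : ℝ))⟫_ℝ • EuclideanSpace.single (2 : Fin 3) (1 : ℝ)‖ ≤
      r⁻¹ * ⟪w, (EuclideanSpace.single (2 : Fin 3) (1 : ℝ))⟫_ℝ := by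
  set e₃ : EuclideanSpace ℝ (Fin 3) := EuclideanSpace.single (2 : Fin 3) (1 : ℝ) with he₃
  set h : EuclideanSpace ℝ (Fin 3) := w - ⟪w, e₃⟫_ℝ • e₃ with hh
  have he₃1 : ‖e₃‖ = 1 := by rw [he₃]; simp
  have he₃e₃ : ⟪e₃, e₃⟫_ℝ = 1 := by rw [real_inner_self_eq_norm_sq, he₃1, one_pow]
  -- `ω₃ ≥ 0` (the centre of the ball)
  have hw3 : 0 ≤ ⟪w, e₃⟫_ℝ := hball e₃ (by rw [sub_self, norm_zero]; exact hr.le)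
  by_cases hh0 : h = 0
  · rw [hh0, norm_zero]
    exact mul_nonneg (inv_nonneg.2 hr.le) hw3
  · have hhn : 0 < ‖h‖ := norm_pos_iff.2 hh0
    -- `⟪w, h⟫ = ‖h‖²`
    have hwh : ⟪w, h⟫_ℝ = ‖h‖ ^ 2 := by
      have h1 : ⟪h, h⟫_ℝ = ⟪w, h⟫_ℝ - ⟪w, e₃⟫_ℝ * ⟪e₃, h⟫_ℝ := by
        rw [hh, inner_sub_left, real_inner_smul_left]
      have h2 : ⟪e₃, h⟫_ℝ = 0 := by
        rw [hh, inner_sub_right, real_inner_smul_right, he₃e₃, mul_one, real_inner_comm, sub_self]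
      rw [h2, mul_zero, sub_zero, real_inner_self_eq_norm_sq] at h1
      exact h1.symm
    -- the test direction `e = e₃ − r • ‖h‖⁻¹ • h`
    set e : EuclideanSpace ℝ (Fin 3) := e₃ - r • (‖h‖⁻¹ • h) with he
    have hdist : ‖e - e₃‖ ≤ r := by
      rw [he, sub_sub_cancel_left, norm_neg, norm_smul, norm_smul, norm_inv, norm_norm,
        inv_mul_cancel₀ hhn.ne', mul_one, Real.norm_of_nonneg hr.le]
    have key := hball e hdist
    rw [he, inner_sub_right, real_inner_smul_right, real_inner_smul_right, hwh] at key
    -- `key : 0 ≤ ⟪w,e₃⟫ − r * (‖h‖⁻¹ * ‖h‖²)`, i.e. `r ‖h‖ ≤ ⟪w, e₃⟫`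
    have hsimp : ‖h‖⁻¹ * ‖h‖ ^ 2 = ‖h‖ := by field_simp
    rw [hsimp] at key
    rw [le_inv_mul_iff₀' hr]
    linarith

/-- **Pointwise Lei–Ren–Tian cone for the profile**: if the sign cone of `v` contains the ball of radius `r > 0` about
`e₃`, then `‖ω(s,y) − ω₃(s,y)e₃‖ ≤ r⁻¹ ω₃(s,y)` on the whole backward slab. [cite: LeiRenTian2025, Rem 1.2] -/
theorem norm_horizontal_le_of_ball_subset_signCone {r : ℝ} (hr : 0 < r)
    (hball : ∀ e : EuclideanSpace ℝ (Fin 3), ‖e - EuclideanSpace.single (2 : Fin 3) (1 : ℝ)‖ ≤ r →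
      ∀ s < (0 : ℝ), ∀ y, 0 ≤ ⟪curl (v s) y, e⟫_ℝ) :
    ∀ s < (0 : ℝ), ∀ y, ‖curl (v s) y -
        ⟪curl (v s) y, (EuclideanSpace.single (2 : Fin 3) (1 : ℝ))⟫_ℝ • EuclideanSpace.single (2 : Fin 3) (1 : ℝ)‖ ≤
      r⁻¹ * ⟪curl (v s) y, (EuclideanSpace.single (2 : Fin 3) (1 : ℝ))⟫_ℝ :=
  fun s hs y => norm_sub_inner_smul_le_of_ball hr fun e he => hball e he s hs y

/-! ### §2 The circle-averaged cone with `K = r⁻¹`, `M = 0` -/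

/-- **Circle-averaged cone from the pointwise cone**: for a class profile whose sign cone contains the ball of radius
`r` about `e₃`, on every axis circle `∮ ‖ω_h‖ ρ dθ ≤ r⁻¹ ∮ ω₃ ρ dθ` (`ρ ≥ 0`). [cite: LeiRenTian2025, Rem 1.2] -/
theorem circleCone_of_ball_subset_signCone (hrate : HasTypeITimeDecay C v)
    (hcont : ContinuousOn (uncurry v) (Iio (0 : ℝ) ×ˢ univ))
    (hmild : ∀ s t : ℝ, s < t → t < 0 → ∀ x,
      v t x = UnboundedOperators.heatExtension (v s) (t - s) x - oseenDuhamel 1 s v v t x)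
    (hdiv : ∀ t < 0, VectorCalculus.IsDivFree (v t))
    {r : ℝ} (hr : 0 < r)
    (hball : ∀ e : EuclideanSpace ℝ (Fin 3), ‖e - EuclideanSpace.single (2 : Fin 3) (1 : ℝ)‖ ≤ r →
      ∀ s < (0 : ℝ), ∀ y, 0 ≤ ⟪curl (v s) y, e⟫_ℝ)
    {s : ℝ} (hs : s < 0) {ρ : ℝ} (hρ : 0 ≤ ρ) (z : ℝ) :
    ∫ θ in (0 : ℝ)..(2 * Real.pi), ‖curl (v s) (WithLp.toLp 2 ![ρ * Real.cos θ, ρ * Real.sin θ, z] : EuclideanSpace ℝ (Fin 3)) -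
        ⟪curl (v s) (WithLp.toLp 2 ![ρ * Real.cos θ, ρ * Real.sin θ, z] : EuclideanSpace ℝ (Fin 3)),
          (EuclideanSpace.single (2 : Fin 3) (1 : ℝ))⟫_ℝ • (EuclideanSpace.single (2 : Fin 3) (1 : ℝ))‖ * ρ ≤
      r⁻¹ * (∫ θ in (0 : ℝ)..(2 * Real.pi), ⟪curl (v s) (WithLp.toLp 2 ![ρ * Real.cos θ, ρ * Real.sin θ, z] :
        EuclideanSpace ℝ (Fin 3)), (EuclideanSpace.single (2 : Fin 3) (1 : ℝ))⟫_ℝ * ρ) + 0 * ρ := by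
  have hpt := norm_horizontal_le_of_ball_subset_signCone hr hball s hs
  have hcurl : Continuous (curl (v s)) :=
    continuousOn_univ.1
      (analyticOnNhd_curl ((isTypeIAncientMild_of_class hrate hcont hmild hdiv).analyticOnNhd_slice_univ hs)).continuousOn
  set e₃ : EuclideanSpace ℝ (Fin 3) := EuclideanSpace.single (2 : Fin 3) (1 : ℝ) with he₃
  set pt : ℝ → EuclideanSpace ℝ (Fin 3) :=
    fun θ => (WithLp.toLp 2 ![ρ * Real.cos θ, ρ * Real.sin θ, z] : EuclideanSpace ℝ (Fin 3)) with hpt_def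
  have hcirc : Continuous fun θ : ℝ => curl (v s) (pt θ) := continuous_comp_circlePt hcurl ρ z
  have hinner : Continuous fun θ : ℝ => ⟪curl (v s) (pt θ), e₃⟫_ℝ :=
    Continuous.inner (𝕜 := ℝ) hcirc continuous_const
  have hsub : Continuous fun θ : ℝ => curl (v s) (pt θ) - ⟪curl (v s) (pt θ), e₃⟫_ℝ • e₃ :=
    hcirc.sub (hinner.smul continuous_const)
  have hFc : Continuous fun θ : ℝ => ‖curl (v s) (pt θ) - ⟪curl (v s) (pt θ), e₃⟫_ℝ • e₃‖ * ρ :=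
    hsub.norm.mul continuous_const
  have hGc : Continuous fun θ : ℝ => r⁻¹ * (⟪curl (v s) (pt θ), e₃⟫_ℝ * ρ) :=
    continuous_const.mul (hinner.mul continuous_const)
  have hle := intervalIntegral.integral_mono_on (μ := volume) (le_of_lt Real.two_pi_pos)
    (hFc.intervalIntegrable 0 (2 * Real.pi)) (hGc.intervalIntegrable 0 (2 * Real.pi))
    (fun θ _ => by
      rw [← mul_assoc]
      exact mul_le_mul_of_nonneg_right (hpt (pt θ)) hρ)
  rw [intervalIntegral.integral_const_mul] at hle
  rw [zero_mul, add_zero]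
  exact hle

/-! ### §3 The known rung: interior sign cone about `e₃` ⇒ regular apex -/

/-- **A sign cone containing a ball about `e₃` forces a regular apex** (the dimension-3 case of line `signcone`, kernel
form): for a profile of the route's four-hypothesis class, if every direction within `r > 0` of `e₃` is one-signed, the
apex is not backward-singular — pointwise cone (§1) ⇒ circle-averaged cone with `K = r⁻¹`, `M = 0` (§2) ⇒ crux 26889
`AveragedConeLiouville` (PROVED) with the automatic energy class. [cite: LeiRenTian2025, Thm 1.1] -/
theorem not_isBackwardSingularPoint_of_ball_subset_signCone (hrate : HasTypeITimeDecay C v)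
    (hcont : ContinuousOn (uncurry v) (Iio (0 : ℝ) ×ˢ univ))
    (hmild : ∀ s t : ℝ, s < t → t < 0 → ∀ x,
      v t x = UnboundedOperators.heatExtension (v s) (t - s) x - oseenDuhamel 1 s v v t x)
    (hdiv : ∀ t < 0, VectorCalculus.IsDivFree (v t))
    {r : ℝ} (hr : 0 < r)
    (hball : ∀ e : EuclideanSpace ℝ (Fin 3), ‖e - EuclideanSpace.single (2 : Fin 3) (1 : ℝ)‖ ≤ r →
      ∀ s < (0 : ℝ), ∀ y, 0 ≤ ⟪curl (v s) y, e⟫_ℝ) :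
    ¬ IsBackwardSingularPoint v 0 := by
  obtain ⟨π, H, hsw, hwg, hI⟩ := exists_energyClass_of_typeI hrate hcont hmild hdiv
  have hnn : ∀ s < (0 : ℝ), ∀ y, 0 ≤ ⟪curl (v s) y, (EuclideanSpace.single (2 : Fin 3) (1 : ℝ))⟫_ℝ :=
    hball _ (by rw [sub_self, norm_zero]; exact hr.le)
  refine AxisTwistDoorAveragedConeLiouvilleHolds.averagedConeLiouville_holds C v π H hrate hcont hmild hdiv hsw hwg hI
    hnn ⟨r⁻¹, 0, inv_nonneg.2 hr.le, le_rfl, ?_⟩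
  intro s _ hs ρ hρ _ z _
  exact circleCone_of_ball_subset_signCone hrate hcont hmild hdiv hr hball hs hρ.le z

/-! ### §4 Any interior direction (appended): rotate `e₀/‖e₀‖` to `e₃` -/

/-- **A sign cone with non-empty interior forces a regular apex — any centre.**  For a profile of the route's
four-hypothesis class: if every direction within `r > 0` of the unit vector `e₀/‖e₀‖` (`e₀ ≠ 0`) is one-signed, the apex
is not backward-singular.  Conjugate by a determinant-one linear isometry `L` with `L⁻¹e₃ = e₀/‖e₀‖`
(`exists_linearIsometryEquiv_det_one_symm_single_two`): the class is covariant (`class_conj_linearIsometryEquiv`), the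
pseudovector law `⟪curl v'(s) y, e'⟫ = ⟪curl v(s)(L⁻¹y), L⁻¹e'⟫` (`inner_curl_conj_linearIsometryEquiv`, `det L = 1`)
turns the ball about `e₀/‖e₀‖` into the ball about `e₃`, §3 applies to `v'`, and the origin singularity is covariant
(`LIE.isBackwardSingularPoint_zero_conj`). [cite: LeiRenTian2025, Thm 1.1 and Rem 1.2] -/
theorem not_isBackwardSingularPoint_of_ball_subset_signCone_dir (hrate : HasTypeITimeDecay C v)
    (hcont : ContinuousOn (uncurry v) (Iio (0 : ℝ) ×ˢ univ))
    (hmild : ∀ s t : ℝ, s < t → t < 0 → ∀ x,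
      v t x = UnboundedOperators.heatExtension (v s) (t - s) x - oseenDuhamel 1 s v v t x)
    (hdiv : ∀ t < 0, VectorCalculus.IsDivFree (v t))
    {e₀ : EuclideanSpace ℝ (Fin 3)} (he₀ : e₀ ≠ 0) {r : ℝ} (hr : 0 < r)
    (hball : ∀ e : EuclideanSpace ℝ (Fin 3), ‖e - (‖e₀‖⁻¹ : ℝ) • e₀‖ ≤ r → ∀ s < (0 : ℝ), ∀ y, 0 ≤ ⟪curl (v s) y, e⟫_ℝ) :
    ¬ IsBackwardSingularPoint v 0 := by
  intro hsing
  obtain ⟨L, hL, hdet⟩ :=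
    HalfSpaceWindowDoorCirculationCarryingRigidityRotate.exists_linearIsometryEquiv_det_one_symm_single_two he₀
  obtain ⟨hrate', hcont', hmild', hdiv'⟩ :=
    PoloidalWindowDoorPoloidalWindowRigidityRotate.class_conj_linearIsometryEquiv L hrate hcont hmild hdiv
  have hsing' := RellichScarSimilarityCovariance.LIE.isBackwardSingularPoint_zero_conj L hsing
  refine not_isBackwardSingularPoint_of_ball_subset_signCone hrate' hcont' hmild' hdiv' hr ?_ hsing'
  intro e' he' s hs y
  -- the pseudovector law with `det L = 1`
  have hkey : ⟪curl (fun z => L (v s (L.symm z))) y, e'⟫_ℝ = ⟪curl (v s) (L.symm y), L.symm e'⟫_ℝ := by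
    have h := inner_curl_conj_linearIsometryEquiv L (v s) y (L.symm e')
    rw [LinearIsometryEquiv.apply_symm_apply, hdet, one_mul] at h
    exact h
  show 0 ≤ ⟪curl (fun z => L (v s (L.symm z))) y, e'⟫_ℝ
  rw [hkey]
  refine hball (L.symm e') ?_ s hs (L.symm y)
  rw [← hL, ← map_sub, LinearIsometryEquiv.norm_map]
  exact he'

/-! ### §5 Interior of the sign cone non-empty ⇒ regular apex (appended; phrased with `SignCone` of
`…Theorems.AxisTwistDoorSignConeDefs`, ns-imp-p1 p648694) -/

/-- **Any interior point of the sign cone, any centre (possibly not unit, possibly `0`)**: if some open ball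
`ball e₀ r`, `r > 0`, consists of one-signed directions, the apex is not backward-singular.  (If `e₀ = 0` the cone is all
of `ℝ³`, and the ball about `e₃` works; otherwise rescale to the ball of radius `r/(2‖e₀‖)` about `e₀/‖e₀‖`, using that
one-signed directions form a cone.) [cite: LeiRenTian2025, Thm 1.1 and Rem 1.2] -/
theorem not_isBackwardSingularPoint_of_ball_oneSigned (hrate : HasTypeITimeDecay C v)
    (hcont : ContinuousOn (uncurry v) (Iio (0 : ℝ) ×ˢ univ))
    (hmild : ∀ s t : ℝ, s < t → t < 0 → ∀ x,
      v t x = UnboundedOperators.heatExtension (v s) (t - s) x - oseenDuhamel 1 s v v t x)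
    (hdiv : ∀ t < 0, VectorCalculus.IsDivFree (v t))
    {e₀ : EuclideanSpace ℝ (Fin 3)} {r : ℝ} (hr : 0 < r)
    (hball : ∀ e : EuclideanSpace ℝ (Fin 3), ‖e - e₀‖ < r → ∀ s < (0 : ℝ), ∀ y, 0 ≤ ⟪curl (v s) y, e⟫_ℝ) :
    ¬ IsBackwardSingularPoint v 0 := by
  by_cases he₀ : e₀ = 0
  · -- every direction of norm `< r` is one-signed, hence (cone) every direction: use the ball about `e₃`
    refine not_isBackwardSingularPoint_of_ball_subset_signCone hrate hcont hmild hdiv one_pos ?_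
    intro e _ s hs y
    -- `(r/2)/‖e‖ • e` (or `e = 0`) lies in the ball about `0`
    by_cases he : e = 0
    · rw [he, inner_zero_right]
    · have hne : 0 < ‖e‖ := norm_pos_iff.2 he
      set c : ℝ := r / 2 / ‖e‖ with hc
      have hc0 : 0 < c := by positivity
      have hmem : ‖c • e - e₀‖ < r := by
        rw [he₀, sub_zero, norm_smul, Real.norm_of_nonneg hc0.le, hc, div_mul_cancel₀ _ hne.ne']
        linarith
      have h := hball (c • e) hmem s hs y
      rw [real_inner_smul_right] at h
      exact (mul_nonneg_iff_of_pos_left hc0).1 h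
  · have hn : 0 < ‖e₀‖ := norm_pos_iff.2 he₀
    refine not_isBackwardSingularPoint_of_ball_subset_signCone_dir hrate hcont hmild hdiv he₀
      (r := r / 2 / ‖e₀‖) (by positivity) ?_
    intro e he s hs y
    -- `‖e₀‖ • e` lies in the ball about `e₀`
    have hmem : ‖‖e₀‖ • e - e₀‖ < r := by
      have h1 : ‖e₀‖ • e - e₀ = ‖e₀‖ • (e - (‖e₀‖⁻¹ : ℝ) • e₀) := by
        rw [smul_sub, smul_smul, mul_inv_cancel₀ hn.ne', one_smul]
      rw [h1, norm_smul, Real.norm_of_nonneg hn.le]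
      calc ‖e₀‖ * ‖e - (‖e₀‖⁻¹ : ℝ) • e₀‖ ≤ ‖e₀‖ * (r / 2 / ‖e₀‖) := by gcongr
        _ = r / 2 := by field_simp
        _ < r := by linarith
    have h := hball (‖e₀‖ • e) hmem s hs y
    rw [real_inner_smul_right] at h
    exact (mul_nonneg_iff_of_pos_left hn).1 h

/-- **INTERIOR OF THE SIGN CONE NON-EMPTY ⇒ REGULAR APEX** (the dimension-3 case of line `signcone`, stated with the
official `SignCone`): for a profile of the route's class, `(interior (SignCone v)).Nonempty → ¬ IsBackwardSingularPoint v 0`.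
Hence the open stub `StubDihedralRigidity` may assume `interior (SignCone w) = ∅` (planar-wedge case). [cite:
LeiRenTian2025, Thm 1.1] -/
theorem not_isBackwardSingularPoint_of_interior_signCone_nonempty (hrate : HasTypeITimeDecay C v)
    (hcont : ContinuousOn (uncurry v) (Iio (0 : ℝ) ×ˢ univ))
    (hmild : ∀ s t : ℝ, s < t → t < 0 → ∀ x,
      v t x = UnboundedOperators.heatExtension (v s) (t - s) x - oseenDuhamel 1 s v v t x)
    (hdiv : ∀ t < 0, VectorCalculus.IsDivFree (v t))
    (hint : (interior (AxisTwistDoorSignConeDefs.SignCone v)).Nonempty) :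
    ¬ IsBackwardSingularPoint v 0 := by
  obtain ⟨e₀, he₀⟩ := hint
  obtain ⟨r, hr, hsub⟩ := Metric.isOpen_iff.1 isOpen_interior e₀ he₀
  refine not_isBackwardSingularPoint_of_ball_oneSigned hrate hcont hmild hdiv (e₀ := e₀) hr ?_
  intro e he s hs y
  have hmem : e ∈ AxisTwistDoorSignConeDefs.SignCone v :=
    interior_subset (hsub (mem_ball.2 (by rwa [dist_eq_norm])))
  exact hmem s hs y

end Summit.NavierStokesRegularity.NavierStokesRegularity.Theorems.AxisTwistDoorSignConeInterior

end
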